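import Literature.Claims.NS.ClayVariants
import Literature.Analysis.FluidPDE.ClassicalNSFiniteEnergyEquality
import Literature.Analysis.FluidPDE.TaoEnstrophyLocalisationProofs
import Literature.Analysis.FluidPDE.NSLerayHopf
import HarnessLib

/-!
# Clay (A) reference — PER-SLAB finite energy suffices for Fefferman's (7)

Companion to `ClayR3BlowupAlternative.lean`, `ClayR3EnstrophyBridge.lean`, … (keeper `ns-claims-lit-4`;
theorems only). Many regularity manuscripts on `ℝ³` state their conclusion as «a global smooth solution
`u ∈ C([0,∞); L²)`», «`u ∈ L^∞([0,T]; H¹)` for every `T`», «`E(t) < ∞` for all `t`» — an energy that is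
finite, or bounded, on every COMPACT time slab, whereas Fefferman's (7) asks ONE bound
`∫|u(x,t)|² dx < C` for all `t ≥ 0`. For classical solutions of the unforced system the two agree, by
Leray's energy inequality `∫|u(t)|² ≤ ∫|u₀|²` for finite-energy classical solutions (tree:
`IsClassicalNSSolutionOn.integral_norm_sq_le_of_finiteEnergy`, `ClassicalNSFiniteEnergyEquality.lean`,
Leray 1934 §17 / Tao 2013 Lemma 8.1). This file records the resulting Clay doors:

* `lintegral_norm_sq_le_datum_of_slabBoundedEnergy` — along a classical solution on `[0,∞) × ℝ³` whose
  energy is bounded on every `[0, T]`, `∫|u(t)|² ≤ ∫|u(0)|²` for every `t ≥ 0` (lower Lebesgue integrals);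
* `hasBoundedEnergy_of_slabBoundedEnergy` — hence (7) `HasBoundedEnergy u` as soon as `∫|u(0)|² < ∞`;
* `clayR3_solvable_of_classical_slabBoundedEnergy` — a global classical solution from a datum `u₀` with
  `∫|u₀|² < ∞` (in particular a Clay datum of class (4)) whose energy is bounded on every compact slab IS
  a Clay solution: `clayR3.Solvable ν 0 u₀`;
* `clayR3_solvable_of_classical_slabFiniteEnergy_continuous` — the same with the frequent printed form
  «`t ↦ ∫|u(t)|²` finite and continuous on `[0,∞)`» (continuity on the compact slab gives the bound).

§2 (half-open slabs — the bookkeeping of «suitable weak solutions on `ℝ³ × (0, T)` with finite energy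
`sup ∫|u|² + ∫∫|∇u|² ≤ M²`», instantiated on classical solutions; keeper lit-4 g8):

* `lintegral_dissipation_le_initial_of_Icc` / `…_of_Ico` — `2ν ∫₀ᵀ∫|∇u|²_F ≤ ∫|u(0)|²` in `[0, ∞]`, on a closed
  slab resp. a HALF-OPEN slab `[0, T)` with energy bounded on `[0, T)` (monotone convergence in `T' ↑ T`);
* `iSup_lintegral_norm_sq_le_initial_of_Ico` — `sup_{(0,T)} ∫|u|² ≤ ∫|u(0)|²`;
* `lintegral_prod_dissipation_eq` — Tonelli: the space–time integral of `|∇u|²_F` over `(0,T) × ℝ³` is the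
  iterated one;
* `energyBudget_le_initial_of_Ico` — `sup_{(0,T)} ∫|u|² + ∫∫_{(0,T)×ℝ³}|∇u|²_F ≤ (1 + (2ν)⁻¹) ∫|u(0)|²`: with a
  (4)-datum the right-hand side is finite, which discharges «every solution of the class carries SOME energy
  bound `M`» steps of CKN / ESS-type manuscripts.

## References
* J. Leray, Acta Math. 63 (1934), §17 (3.4) p. 220 (energy inequality). [Leray1934]
* T. Tao, *Localisation and compactness properties of the Navier–Stokes global regularity problem*,
  Anal. PDE 6 (2013), Lemma 8.1. [Tao2011]
* C. L. Fefferman, CMI problem description (2006), (A) with (7) p. 2. [FeffermanClay2006]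
* O. Kallenberg, *Foundations of Modern Probability*, 3rd ed. (2021), Thm 1.27 (Fubini–Tonelli) p. 30. [Kallenberg2021]

WHAT THIS IS NOT: not a claim about NS regularity or blow-up; not a claim about any author beyond the
typed locator.
-/

noncomputable section

open scoped ContDiff ENNReal NNReal Topology

namespace Literature.Claims.NS.ClayVariants

open Set Filter MeasureTheory Function Literature.Analysis Literature.Analysis.FluidPDE

variable {ν : ℝ} {u₀ : EuclideanSpace ℝ (Fin 3) → EuclideanSpace ℝ (Fin 3)}
  {u : ℝ → EuclideanSpace ℝ (Fin 3) → EuclideanSpace ℝ (Fin 3)} {p : ℝ → EuclideanSpace ℝ (Fin 3) → ℝ}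

/-- Along a classical solution on a closed slab `[0, S]`, at a time `τ` of the slab where the energy is
finite, `∫⁻ ‖u(τ)‖ₑ² = ofReal (∫ ‖u(τ)‖²)` (the slice is continuous, so `‖u(τ)‖²` is integrable).
[folklore] -/
private theorem lintegral_eq_ofReal_integral_of_lt_top {S τ : ℝ}
    (hcl : IsClassicalNSSolutionOn (Icc 0 S) ν 0 u p) (hτ : τ ∈ Icc 0 S)
    (hfin : (∫⁻ x, ‖u τ x‖ₑ ^ 2) < ⊤) :
    (∫⁻ x, ‖u τ x‖ₑ ^ 2) = ENNReal.ofReal (∫ x, ‖u τ x‖ ^ 2) := by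
  have hint : Integrable (fun x => ‖u τ x‖ ^ 2) :=
    integrable_sq_norm_of_lintegral_lt_top (hcl.contDiff_velocity hτ).continuous hfin
  rw [ofReal_integral_eq_lintegral_ofReal hint (Eventually.of_forall fun x => sq_nonneg _)]
  refine lintegral_congr fun x => ?_
  rw [← ofReal_norm, ENNReal.ofReal_pow (norm_nonneg _)]

/-- **Leray's energy inequality, slab-bounded form**: along a classical solution of the unforced system on
`[0, ∞) × ℝ³` (`ν > 0`) whose energy is BOUNDED ON EVERY COMPACT SLAB `[0, T]`, the energy never exceeds
its initial value: `∫ ‖u(t)‖² ≤ ∫ ‖u(0)‖²` for all `t ≥ 0` (lower Lebesgue integrals; from the tree's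
finite-energy energy inequality `IsClassicalNSSolutionOn.integral_norm_sq_le_of_finiteEnergy` on the slab
`[0, t + 1]`). [cite: Leray1934, §17 (3.4) p. 220] [cite: Tao2011, Lemma 8.1] -/
theorem lintegral_norm_sq_le_datum_of_slabBoundedEnergy (hν : 0 < ν)
    (hcl : IsClassicalNSSolutionOn (Ici 0) ν 0 u p)
    (hE : ∀ T : ℝ, 0 < T → ∃ A : ℝ≥0∞, A < ⊤ ∧ ∀ t ∈ Icc 0 T, (∫⁻ x, ‖u t x‖ₑ ^ 2) ≤ A)
    {t : ℝ} (ht : 0 ≤ t) :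
    (∫⁻ x, ‖u t x‖ₑ ^ 2) ≤ ∫⁻ x, ‖u 0 x‖ₑ ^ 2 := by
  have hT : (0 : ℝ) < t + 1 := by linarith
  have hclT : IsClassicalNSSolutionOn (Icc 0 (t + 1)) ν 0 u p :=
    hcl.mono Icc_subset_Ici_self (uniqueDiffOn_Icc hT)
  obtain ⟨A, hA, hAle⟩ := hE (t + 1) hT
  have ht' : t ∈ Icc 0 (t + 1) := ⟨ht, by linarith⟩
  have h0' : (0 : ℝ) ∈ Icc 0 (t + 1) := ⟨le_rfl, hT.le⟩
  have hreal : ∫ x, ‖u t x‖ ^ 2 ≤ ∫ x, ‖u 0 x‖ ^ 2 :=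
    hclT.integral_norm_sq_le_of_finiteEnergy hν hT ⟨A, hA, hAle⟩ le_rfl ht (by linarith)
  rw [lintegral_eq_ofReal_integral_of_lt_top hclT ht' ((hAle t ht').trans_lt hA),
    lintegral_eq_ofReal_integral_of_lt_top hclT h0' ((hAle 0 h0').trans_lt hA)]
  exact ENNReal.ofReal_le_ofReal hreal

/-- **Per-slab bounded energy ⇒ Fefferman's (7)**: a classical solution on `[0, ∞) × ℝ³` of the unforced
system (`ν > 0`) with finite initial energy whose energy is bounded on every compact slab has uniformly
bounded energy, `HasBoundedEnergy u` (bound `∫|u(0)|²`). [cite: FeffermanClay2006, (7) p. 2]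
[cite: Leray1934, §17 (3.4) p. 220] -/
theorem hasBoundedEnergy_of_slabBoundedEnergy (hν : 0 < ν)
    (hcl : IsClassicalNSSolutionOn (Ici 0) ν 0 u p) (h0 : (∫⁻ x, ‖u 0 x‖ₑ ^ 2) < ⊤)
    (hE : ∀ T : ℝ, 0 < T → ∃ A : ℝ≥0∞, A < ⊤ ∧ ∀ t ∈ Icc 0 T, (∫⁻ x, ‖u t x‖ₑ ^ 2) ≤ A) :
    HasBoundedEnergy u :=
  ⟨∫⁻ x, ‖u 0 x‖ₑ ^ 2, h0, fun _ ht => lintegral_norm_sq_le_datum_of_slabBoundedEnergy hν hcl hE ht⟩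

/-- **CLAY DOOR — a global classical solution with per-slab bounded energy IS a Clay solution**: for
`ν > 0`, a datum `u₀` with `∫|u₀|² < ∞` and a classical solution `(u, p)` of the unforced system on
`[0, ∞) × ℝ³` with `u(0) = u₀` whose energy is bounded on every `[0, T]`, the triple `(ν, 0, u₀)` is
solvable in Fefferman's sense (A): smooth on the closed half-space ((6)), the equations ((1)–(3)), bounded
energy ((7)). Typists: a claimed «global smooth solution with `u ∈ C([0,∞);L²)` / `L^∞(0,T;H¹)` ∀T /
`E(t) < ∞`» from a Clay datum gives `clayR3.Solvable` through this door with no energy-inequality step.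
[cite: FeffermanClay2006, (A) with (1)–(3), (6), (7) p. 2] [cite: Leray1934, §17 (3.4) p. 220] -/
theorem clayR3_solvable_of_classical_slabBoundedEnergy (hν : 0 < ν)
    (h0 : (∫⁻ x, ‖u₀ x‖ₑ ^ 2) < ⊤) (hcl : IsClassicalNSSolutionOn (Ici 0) ν 0 u p) (hu0 : u 0 = u₀)
    (hE : ∀ T : ℝ, 0 < T → ∃ A : ℝ≥0∞, A < ⊤ ∧ ∀ t ∈ Icc 0 T, (∫⁻ x, ‖u t x‖ₑ ^ 2) ≤ A) :
    clayR3.Solvable ν 0 u₀ := by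
  obtain ⟨hns, hsu, hsp⟩ :=
    (isNavierStokesSolution_and_smooth_iff (ν := ν) (f := 0) (u₀ := u₀) (u := u) (p := p)).2 ⟨hcl, hu0⟩
  refine ⟨u, p, hsu, hsp, hns, ?_⟩
  show HasBoundedEnergy u
  exact hasBoundedEnergy_of_slabBoundedEnergy hν hcl (hu0 ▸ h0) hE

/-- **The same door with the printed form «`t ↦ ∫|u(t)|²` is finite and continuous on `[0, ∞)`»**
(`u ∈ C([0,∞); L²)` at the level of the energy): continuity on the compact slab `[0, T]` bounds the
energy there. [cite: FeffermanClay2006, (A) with (7) p. 2] [cite: Leray1934, §17 (3.4) p. 220] -/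
theorem clayR3_solvable_of_classical_slabFiniteEnergy_continuous (hν : 0 < ν)
    (h0 : (∫⁻ x, ‖u₀ x‖ₑ ^ 2) < ⊤) (hcl : IsClassicalNSSolutionOn (Ici 0) ν 0 u p) (hu0 : u 0 = u₀)
    (hfin : ∀ t : ℝ, 0 ≤ t → (∫⁻ x, ‖u t x‖ₑ ^ 2) < ⊤)
    (hcont : ContinuousOn (fun t => (∫⁻ x, ‖u t x‖ₑ ^ 2).toReal) (Ici 0)) :
    clayR3.Solvable ν 0 u₀ := by
  refine clayR3_solvable_of_classical_slabBoundedEnergy hν h0 hcl hu0 fun T hT => ?_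
  obtain ⟨M, hM⟩ := (isCompact_Icc : IsCompact (Icc (0 : ℝ) T)).bddAbove_image
    (hcont.mono Icc_subset_Ici_self)
  refine ⟨ENNReal.ofReal M, ENNReal.ofReal_lt_top, fun t ht => ?_⟩
  rw [← ENNReal.ofReal_toReal (hfin t ht.1).ne]
  exact ENNReal.ofReal_le_ofReal (hM ⟨t, ht, rfl⟩)

/-! ## §2. Half-open slabs: the finite-energy budget `sup ∫|u|² + ∫∫|∇u|²` of a classical solution

References as above (Leray 1934 §17 (3.4); Tao 2013 Lemma 8.1, tree `ClassicalNSFiniteEnergyEquality.lean`). -/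

section HalfOpen

variable {T : ℝ}

/-- **Dissipation bound on a closed slab, `[0,∞]`-valued form**: along a classical solution of the unforced
system on `[0, T] × ℝ³` (`ν > 0`, `T > 0`) with finite energy `sup_{[0,T]} ∫|u|² < ∞`,
`2ν ∫₀ᵀ∫ |∇u|²_F ≤ ∫ |u(0)|²` (iterated lower Lebesgue integrals; the energy identity of Leray / Tao L8.1).
[cite: Leray1934, §17 (3.4) p. 220] [cite: Tao2011, Lemma 8.1] -/
theorem lintegral_dissipation_le_initial_of_Icc (hν : 0 < ν) (hT : 0 < T)
    (hcl : IsClassicalNSSolutionOn (Icc 0 T) ν 0 u p)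
    (hE : ∃ A : ℝ≥0∞, A < ⊤ ∧ ∀ t ∈ Icc 0 T, (∫⁻ x, ‖u t x‖ₑ ^ 2) ≤ A) :
    ENNReal.ofReal (2 * ν) *
        ∫⁻ τ in Ioo 0 T, ∫⁻ x, ENNReal.ofReal (frobeniusNormSq (fderiv ℝ (u τ) x)) ≤
      ∫⁻ x, ‖u 0 x‖ₑ ^ 2 := by
  obtain ⟨A, -, -, -, hgrad⟩ := energyClass_of_finiteEnergy hcl hν hT hE
  have hEq := hcl.energyEq_finiteEnergy hν hT hE le_rfl hT.le le_rfl
  set D := ∫⁻ τ in Ioo 0 T, ∫⁻ x, ENNReal.ofReal (frobeniusNormSq (fderiv ℝ (u τ) x)) with hD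
  have hKT : 0 ≤ VectorCalculus.kineticEnergy (u T) := kineticEnergy_nonneg _
  have h1 : 2 * ν * D.toReal ≤ ∫ x, ‖u 0 x‖ ^ 2 := by
    simp only [VectorCalculus.kineticEnergy] at hEq hKT
    linarith
  obtain ⟨A', hA', hA'le⟩ := hE
  have h0fin : (∫⁻ x, ‖u 0 x‖ₑ ^ 2) < ⊤ := (hA'le 0 ⟨le_rfl, hT.le⟩).trans_lt hA'
  calc ENNReal.ofReal (2 * ν) * D = ENNReal.ofReal (2 * ν) * ENNReal.ofReal D.toReal := by
        rw [ENNReal.ofReal_toReal hgrad.ne]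
    _ = ENNReal.ofReal (2 * ν * D.toReal) := (ENNReal.ofReal_mul (by positivity)).symm
    _ ≤ ENNReal.ofReal (∫ x, ‖u 0 x‖ ^ 2) := ENNReal.ofReal_le_ofReal h1
    _ = ∫⁻ x, ‖u 0 x‖ₑ ^ 2 :=
        (lintegral_eq_ofReal_integral_of_lt_top hcl ⟨le_rfl, hT.le⟩ h0fin).symm

/-- `(0, T)` is the increasing union of the intervals `(0, T − T/(n+2))`. [folklore] -/
private theorem iUnion_Ioo_sub_eq (hT : 0 < T) :
    (⋃ n : ℕ, Ioo (0 : ℝ) (T - T / (n + 2))) = Ioo 0 T := by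
  apply Subset.antisymm
  · refine iUnion_subset fun n => Ioo_subset_Ioo le_rfl ?_
    have : 0 < T / (n + 2) := by positivity
    linarith
  · intro τ hτ
    rw [mem_iUnion]
    have hpos : 0 < T - τ := sub_pos.mpr hτ.2
    obtain ⟨n, hn⟩ := exists_nat_gt (T / (T - τ))
    refine ⟨n, hτ.1, ?_⟩
    have h2 : T / (T - τ) < (n : ℝ) + 2 := by linarith
    have h3 : T < ((n : ℝ) + 2) * (T - τ) := (div_lt_iff₀ hpos).1 h2
    have h4 : T / ((n : ℝ) + 2) < T - τ := by
      rw [div_lt_iff₀ (by positivity)]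
      linarith [mul_comm ((n : ℝ) + 2) (T - τ)]
    linarith

/-- **Dissipation bound on a HALF-OPEN slab** (the bookkeeping of «suitable weak solutions on
`ℝ³ × (0, T)` with finite energy»): along a classical solution of the unforced system on `[0, T) × ℝ³`
(`ν > 0`) whose energy is bounded on `[0, T)`, `2ν ∫₀ᵀ∫ |∇u|²_F ≤ ∫ |u(0)|²` — by the closed-slab bound on
every `[0, T']`, `T' < T`, and monotone convergence in `T'`. [cite: Leray1934, §17 (3.4) p. 220]
[cite: Tao2011, Lemma 8.1] -/
theorem lintegral_dissipation_le_initial_of_Ico (hν : 0 < ν) (hT : 0 < T)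
    (hcl : IsClassicalNSSolutionOn (Ico 0 T) ν 0 u p)
    (hE : ∃ A : ℝ≥0∞, A < ⊤ ∧ ∀ t ∈ Ico 0 T, (∫⁻ x, ‖u t x‖ₑ ^ 2) ≤ A) :
    ENNReal.ofReal (2 * ν) *
        ∫⁻ τ in Ioo 0 T, ∫⁻ x, ENNReal.ofReal (frobeniusNormSq (fderiv ℝ (u τ) x)) ≤
      ∫⁻ x, ‖u 0 x‖ₑ ^ 2 := by
  obtain ⟨A, hA, hAle⟩ := hE
  set c : ℕ → ℝ := fun n => T - T / (n + 2) with hc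
  have hcpos : ∀ n, 0 < c n := fun n => by
    have h1 : T / ((n : ℝ) + 2) < T := by
      rw [div_lt_iff₀ (by positivity)]
      nlinarith
    show 0 < T - T / (n + 2)
    linarith
  have hclt : ∀ n, c n < T := fun n => by
    have h1 : 0 < T / ((n : ℝ) + 2) := by positivity
    show T - T / (n + 2) < T
    linarith
  have hdir : Directed (· ⊆ ·) (fun n : ℕ => Ioo (0 : ℝ) (c n)) := by
    refine Monotone.directed_le fun m n hmn => Ioo_subset_Ioo le_rfl ?_
    have hmn' : (m : ℝ) + 2 ≤ (n : ℝ) + 2 := by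
      have : (m : ℝ) ≤ n := Nat.cast_le.mpr hmn
      linarith
    have h1 : T / ((n : ℝ) + 2) ≤ T / ((m : ℝ) + 2) :=
      div_le_div_of_nonneg_left hT.le (by positivity) hmn'
    show T - T / (m + 2) ≤ T - T / (n + 2)
    linarith
  rw [← iUnion_Ioo_sub_eq hT, setLIntegral_iUnion_of_directed _ hdir, ENNReal.mul_iSup]
  refine iSup_le fun n => ?_
  have hcl' : IsClassicalNSSolutionOn (Icc 0 (c n)) ν 0 u p :=
    hcl.mono (Icc_subset_Ico_right (hclt n)) (uniqueDiffOn_Icc (hcpos n))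
  exact lintegral_dissipation_le_initial_of_Icc hν (hcpos n) hcl'
    ⟨A, hA, fun t ht => hAle t ⟨ht.1, ht.2.trans_lt (hclt n)⟩⟩

/-- **Energy non-increase on a half-open slab, `sup` form**: `sup_{t ∈ (0,T)} ∫|u(t)|² ≤ ∫|u(0)|²` along a
classical solution on `[0, T) × ℝ³` (`ν > 0`) with energy bounded on `[0, T)`.
[cite: Leray1934, §17 (3.4) p. 220] [cite: Tao2011, Lemma 8.1] -/
theorem iSup_lintegral_norm_sq_le_initial_of_Ico (hν : 0 < ν)
    (hcl : IsClassicalNSSolutionOn (Ico 0 T) ν 0 u p)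
    (hE : ∃ A : ℝ≥0∞, A < ⊤ ∧ ∀ t ∈ Ico 0 T, (∫⁻ x, ‖u t x‖ₑ ^ 2) ≤ A) :
    (⨆ t ∈ Ioo 0 T, ∫⁻ x, ‖u t x‖ₑ ^ 2) ≤ ∫⁻ x, ‖u 0 x‖ₑ ^ 2 := by
  obtain ⟨A, hA, hAle⟩ := hE
  refine iSup₂_le fun t ht => ?_
  have hcl' : IsClassicalNSSolutionOn (Icc 0 t) ν 0 u p :=
    hcl.mono (Icc_subset_Ico_right ht.2) (uniqueDiffOn_Icc ht.1)
  have hE' : ∃ A : ℝ≥0∞, A < ⊤ ∧ ∀ s ∈ Icc 0 t, (∫⁻ x, ‖u s x‖ₑ ^ 2) ≤ A :=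
    ⟨A, hA, fun s hs => hAle s ⟨hs.1, hs.2.trans_lt ht.2⟩⟩
  have hreal : ∫ x, ‖u t x‖ ^ 2 ≤ ∫ x, ‖u 0 x‖ ^ 2 :=
    hcl'.integral_norm_sq_le_of_finiteEnergy hν ht.1 hE' le_rfl ht.1.le le_rfl
  rw [lintegral_eq_ofReal_integral_of_lt_top hcl' ⟨ht.1.le, le_rfl⟩
      ((hAle t ⟨ht.1.le, ht.2⟩).trans_lt hA),
    lintegral_eq_ofReal_integral_of_lt_top hcl' ⟨le_rfl, ht.1.le⟩
      ((hAle 0 ⟨le_rfl, ht.1.trans ht.2⟩).trans_lt hA)]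
  exact ENNReal.ofReal_le_ofReal hreal

/-- **Tonelli for the dissipation on the open slab**: the space–time lower integral of `|∇u|²_F` over
`(0, T) × ℝ³` equals the iterated one (the integrand is continuous on `[0, T) × ℝ³` for a classical
solution, hence a.e.-measurable on the open slab; Tonelli's theorem for `[0, ∞]`-valued measurable functions on a
product of σ-finite spaces). [cite: Kallenberg2021, Thm 1.27 (7) p. 30] -/
theorem lintegral_prod_dissipation_eq (hcl : IsClassicalNSSolutionOn (Ico 0 T) ν 0 u p) :
    ∫⁻ q in Ioo 0 T ×ˢ (univ : Set (EuclideanSpace ℝ (Fin 3))),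
        ENNReal.ofReal (frobeniusNormSq (fderiv ℝ (u q.1) q.2)) =
      ∫⁻ τ in Ioo 0 T, ∫⁻ x, ENNReal.ofReal (frobeniusNormSq (fderiv ℝ (u τ) x)) := by
  have hcont : ContinuousOn (fun z : ℝ × EuclideanSpace ℝ (Fin 3) => fderiv ℝ (u z.1) z.2)
      (Ico 0 T ×ˢ univ) :=
    (hcl.smooth_velocity.fderiv_slice (uniqueDiffOn_Ico 0 T)).continuousOn
  have h1 : ContinuousOn (fun q : ℝ × EuclideanSpace ℝ (Fin 3) =>
      ENNReal.ofReal (frobeniusNormSq (fderiv ℝ (u q.1) q.2))) (Ico 0 T ×ˢ univ) :=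
    (ENNReal.continuous_ofReal.comp LerayHopfProofs.continuous_frobeniusNormSq).comp_continuousOn hcont
  have hF : AEMeasurable (fun q : ℝ × EuclideanSpace ℝ (Fin 3) =>
      ENNReal.ofReal (frobeniusNormSq (fderiv ℝ (u q.1) q.2)))
      (volume.restrict (Ioo 0 T ×ˢ (univ : Set (EuclideanSpace ℝ (Fin 3))))) :=
    (h1.mono (prod_mono Ioo_subset_Ico_self Subset.rfl)).aemeasurable
      (measurableSet_Ioo.prod MeasurableSet.univ)
  have hμ : (volume : Measure (ℝ × EuclideanSpace ℝ (Fin 3))).restrict (Ioo 0 T ×ˢ univ) =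
      ((volume : Measure ℝ).restrict (Ioo 0 T)).prod (volume : Measure (EuclideanSpace ℝ (Fin 3))) := by
    rw [Measure.volume_eq_prod, ← Measure.prod_restrict, Measure.restrict_univ]
  rw [hμ] at hF ⊢
  exact lintegral_prod _ hF

/-- **The finite-energy budget of a half-open slab** (the «`sup ∫|u|² + ∫∫|∇u|² ≤ M²`» hypothesis of
suitable-weak-solution texts, instantiated on classical solutions): along a classical solution of the
unforced system on `[0, T) × ℝ³` (`ν > 0`, `T > 0`) with energy bounded on `[0, T)`,
`sup_{(0,T)} ∫|u|² + ∫∫_{(0,T)×ℝ³} |∇u|²_F ≤ (1 + (2ν)⁻¹) ∫|u(0)|²`. Typists: with a (4)-datum the right-hand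
side is finite (`ClayDataSobolev`: `HasRapidSpatialDecay.lintegral_enorm_sq_lt_top`), which discharges
«every solution of the class carries some energy bound `M`» steps. [cite: Leray1934, §17 (3.4) p. 220]
[cite: Tao2011, Lemma 8.1] -/
theorem energyBudget_le_initial_of_Ico (hν : 0 < ν) (hT : 0 < T)
    (hcl : IsClassicalNSSolutionOn (Ico 0 T) ν 0 u p)
    (hE : ∃ A : ℝ≥0∞, A < ⊤ ∧ ∀ t ∈ Ico 0 T, (∫⁻ x, ‖u t x‖ₑ ^ 2) ≤ A) :
    (⨆ t ∈ Ioo 0 T, ∫⁻ x, ‖u t x‖ₑ ^ 2) +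
        ∫⁻ q in Ioo 0 T ×ˢ (univ : Set (EuclideanSpace ℝ (Fin 3))),
          ENNReal.ofReal (frobeniusNormSq (fderiv ℝ (u q.1) q.2)) ≤
      (1 + (ENNReal.ofReal (2 * ν))⁻¹) * ∫⁻ x, ‖u 0 x‖ₑ ^ 2 := by
  rw [lintegral_prod_dissipation_eq hcl, add_mul, one_mul]
  refine add_le_add (iSup_lintegral_norm_sq_le_initial_of_Ico hν hcl hE) ?_
  have h := lintegral_dissipation_le_initial_of_Ico hν hT hcl hE
  have hne : ENNReal.ofReal (2 * ν) ≠ 0 := (ENNReal.ofReal_pos.2 (by positivity)).ne'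
  calc ∫⁻ τ in Ioo 0 T, ∫⁻ x, ENNReal.ofReal (frobeniusNormSq (fderiv ℝ (u τ) x))
        = (ENNReal.ofReal (2 * ν))⁻¹ * (ENNReal.ofReal (2 * ν) *
            ∫⁻ τ in Ioo 0 T, ∫⁻ x, ENNReal.ofReal (frobeniusNormSq (fderiv ℝ (u τ) x))) := by
          rw [← mul_assoc, ENNReal.inv_mul_cancel hne ENNReal.ofReal_ne_top, one_mul]
    _ ≤ (ENNReal.ofReal (2 * ν))⁻¹ * ∫⁻ x, ‖u 0 x‖ₑ ^ 2 := by gcongr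

end HalfOpen

end Literature.Claims.NS.ClayVariants

end
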